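import Literature.Probability.Percolation.SeedCrossingRevealment
import Literature.Probability.Percolation.OneArmOSSSBox
import Summits.CriticalPhenomena.PercolationContinuityZ3.Theorems.PercAnnulusCrossingOneArmInfluenceBridge
import Summits.CriticalPhenomena.PercolationContinuityZ3.Theorems.PercAnnulusCrossingNearCriticalWindow
import HarnessLib

/-!
# The annulus crossing `boxCrossing d L N` read on the box cube: seed spheres, the event identity, and the bridges
# (probability, symmetry, pivotality) to the seed-exploration framework

builds on p205010 (kernel theorem, internal audit signed; external expert review pending) — NOT used in this file.

QUANT lane (`prim-quant`), seat p4 (METHOD: differential inequalities for `θ` near `p_c`), gen 14; helper file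
`--supports stmt-CriticalPhenomena-4575`; pure proofs, no definitions, no sorries.  Part 1 of 2 of the `ℤ^d` instance of
Dewan–Muirhead's revealment bound (PTRF 2022, Prop. 2.2 / Lemma 2.9) for the lane's ANNULUS crossing
`SurfaceTension.boxCrossing d L N = {Λ(L) ↔ ∂ⁱⁿΛ(N) in Λ(N)}`; part 2 (`…QuantCrossingDerivRevealment.lean`) does the zone split
and the derivative bound.  On the box cube `PairIdx d N → Bool` of `HutchcroftVolumeBoxCube.lean` with the lattice incidence
`OneArmOSSS.latEdge` and the seed spheres `OneArmOSSS.sphereSeed d N k = {‖v‖_∞ = k}` (p4 gen 13):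

* `exists_sphere_yReach` — discrete intermediate values of `‖·‖_∞` along an open cube path;
* `sconn_iff_mem_boxCrossing` — on lattice configurations, `boxCrossing d L N` holds iff the inner sphere `∂Λ_L` is joined to
  the outer sphere `∂Λ_N` by an open cube path (`SeedExploration.SConn`), `L ≤ N`, `d ≥ 1`;
* `sum_wt_gcross_eq` — `∑_x w(x)·𝟙{∂Λ_L ↔ ∂Λ_N}(x) = P_p(boxCrossing d L N)`;
* `gcross_swap`, `pivCross_swap` — exploring from either sphere computes the same function;
* `real_pivotal_eq_pivCross`, `bias_mul_pivCross_eq` — Russo's term `P_p(e ∈ E(ℤ^d), e pivotal)` is `p(1−p)`-weighted cube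
  pivotality (`SeedExploration.pivCross`), zero off the lattice edges.
[cite: DewanMuirhead2022, §2 Lemma 2.9 and Prop. 2.2]
-/

noncomputable section

namespace Summit.CriticalPhenomena.PercolationContinuityZ3.Theorems.CrossingRevealment

open MeasureTheory Finset Function
open Literature.Probability.Percolation Literature.Probability.LatticeModels
open Literature.Probability.ODonnellSaksSchrammServedio2005
open Literature.Probability.Percolation.GhostExploration Literature.Probability.Percolation.SeedExploration
open Literature.Probability.Percolation.OneArmOSSS Literature.Probability.Percolation.DCT16
open Summit.CriticalPhenomena.PercolationContinuityZ3.Theorems.SurfaceTension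
open Summit.CriticalPhenomena.PercolationContinuityZ3.Theorems.Crossing

variable {d : ℕ}

/-! ### §1. Geometry: spheres and the discrete intermediate value property of the sup norm -/

/-- A site of sup norm `k` lies on the inner vertex boundary of `Λ_k` (`d ≥ 1`). [folklore] -/
theorem mem_innerBoundary_of_boxNorm_eq (hd : 1 ≤ d) {k : ℕ} {x : Site d} (hx : boxNorm x = k) :
    x ∈ innerBoundary (zdGraph d) (box d k) := by
  rcases not_mem_box_or_mem_innerBoundary hd hx.ge with h | h
  · exact absurd (mem_box_iff_boxNorm_le.2 hx.le) h
  · exact h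

/-- Discrete intermediate values: an open cube path from a site of norm `≤ L` to a site of norm `≥ L` passes through
the sphere `∂Λ_L`, and its tail from the LAST such site is again an open path.
[cite: DewanMuirhead2022, §2 proof of Lemma 2.9 (any crossing intersects the hyperplane)] -/
theorem exists_sphere_yReach {N L : ℕ} {y : PairIdx d N → Bool} {a b : BoxV d N}
    (ha : boxNorm a.1 ≤ L) (hb : L ≤ boxNorm b.1) (h : YReach (latEdge d N) y a b) :
    ∃ u : BoxV d N, boxNorm u.1 = L ∧ YReach (latEdge d N) y u b := by
  have key : ∀ w : BoxV d N, YReach (latEdge d N) y a w →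
      boxNorm w.1 < L ∨ ∃ u : BoxV d N, boxNorm u.1 = L ∧ YReach (latEdge d N) y u w := by
    intro w hw
    unfold YReach at hw
    induction hw with
    | refl =>
      by_cases hlt : boxNorm a.1 < L
      · exact Or.inl hlt
      · exact Or.inr ⟨a, by omega, Relation.ReflTransGen.refl⟩
    | @tail v w hv hvw ih =>
      rcases ih with hlt | ⟨u, hu, huv⟩
      · obtain ⟨_, hadj, _⟩ := yAdj_latEdge_iff.1 hvw
        have hstep := boxNorm_le_succ_of_adj hadj
        by_cases hwL : boxNorm w.1 < L
        · exact Or.inl hwL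
        · exact Or.inr ⟨w, by omega, Relation.ReflTransGen.refl⟩
      · exact Or.inr ⟨u, hu, Relation.ReflTransGen.tail huv hvw⟩
  rcases key b h with hlt | h'
  · omega
  · exact h'

/-! ### §2. The annulus crossing read on the box cube, and the three bridges -/

/-- On lattice configurations: `boxCrossing d L N` holds iff the inner sphere `∂Λ_L` is joined to the outer sphere
`∂Λ_N` by an open path of the box cube `Λ(N)` (`L ≤ N`, `d ≥ 1`).
[cite: DewanMuirhead2022, §2 Lemma 2.9 (Cross_k(R) is determined by the clusters of the seed hyperplane)] -/
theorem sconn_iff_mem_boxCrossing (hd : 1 ≤ d) {L N : ℕ} (hLN : L ≤ N) {ω : BondConfig (Site d)}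
    (hω : ω ⊆ (zdGraph d).edgeSet) :
    SConn (latEdge d N) (sphereSeed d N L) (sphereSeed d N N) (toCube N ω) ↔ ω ∈ boxCrossing d L N := by
  constructor
  · rintro ⟨u, hu, b, hb, hub⟩
    change boxNorm u.1 = L at hu
    change boxNorm b.1 = N at hb
    refine (mem_cross_iff_mem_boxCrossing hLN hω).1 ⟨u.1, mem_box_iff_boxNorm_le.2 hu.le, b.1,
      mem_innerBoundary_of_boxNorm_eq hd hb, ?_⟩
    exact mem_openConnIn_of_pathIn (pathIn_of_yReach hub)
  · intro h
    obtain ⟨x, hx, z, hz, hxz⟩ := (mem_cross_iff_mem_boxCrossing hLN hω).2 h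
    have hzb : z ∈ box d N := (mem_innerBoundary_iff.1 hz).1
    have hxN : x ∈ box d N := mem_box_iff_boxNorm_le.2 ((mem_box_iff_boxNorm_le.1 hx).trans hLN)
    have hpath := pathIn_of_mem_openConnIn hxz
    have hyr : YReach (latEdge d N) (toCube N ω) ⟨x, hxN⟩ ⟨z, hzb⟩ :=
      yReach_of_pathIn hω (a := ⟨x, hxN⟩) (b := ⟨z, hzb⟩) hpath
    have hzN : boxNorm z = N := boxNorm_eq_of_mem_innerBoundary hz
    obtain ⟨u, hu, huz⟩ := exists_sphere_yReach (a := ⟨x, hxN⟩) (b := ⟨z, hzb⟩)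
      (mem_box_iff_boxNorm_le.1 hx) (by rw [hzN]; exact hLN) hyr
    exact ⟨u, hu, ⟨z, hzb⟩, hzN, huz⟩

/-- `P_p{∂Λ_L ↔ ∂Λ_N read on the cube} = P_p(boxCrossing d L N)` (the events agree on lattice configurations).
[cite: DewanMuirhead2022, §2 Lemma 2.9 (Cross_k(R) is determined by the exploration)] -/
theorem real_setOf_sconn_eq (hd : 1 ≤ d) {L N : ℕ} (hLN : L ≤ N) (p : unitInterval) :
    (bondPercolation (zdGraph d) p).real
        {ω | SConn (latEdge d N) (sphereSeed d N L) (sphereSeed d N N) (toCube N ω)}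
      = (bondPercolation (zdGraph d) p).real (boxCrossing d L N) :=
  real_congr_of_forall_subset_edgeSet (zdGraph d) p fun _ hω => sconn_iff_mem_boxCrossing hd hLN hω

/-- THE FIRST BRIDGE: `∑_x w(x)·𝟙{∂Λ_L ↔ ∂Λ_N}(x) = P_p(boxCrossing d L N)` on the box cube of `Λ(N)`.
[cite: DewanMuirhead2022, §2 Prop. 2.2 (P_p[Cross_k(R)])] -/
theorem sum_wt_gcross_eq (hd : 1 ≤ d) {L N : ℕ} (hLN : L ≤ N) (p : unitInterval) :
    ∑ x : PairIdx d N → Bool, wt (boxBias d N p) x * gcross (latEdge d N) (sphereSeed d N L) (sphereSeed d N N) x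
      = (bondPercolation (zdGraph d) p).real (boxCrossing d L N) := by
  classical
  rw [← real_setOf_sconn_eq hd hLN p, real_setOf_toCube N p
    (fun x => SConn (latEdge d N) (sphereSeed d N L) (sphereSeed d N N) x)]
  rfl

/-- Symmetry of the crossing function: `𝟙{Z ↔ B} = 𝟙{B ↔ Z}` (open paths of the cube can be reversed).
[cite: DewanMuirhead2022, §2 proof of Prop. 2.2 ("by symmetry" — exploring from either side)] -/
theorem gcross_swap {N : ℕ} (Z B : Set (BoxV d N)) (y : PairIdx d N → Bool) :
    gcross (latEdge d N) Z B y = gcross (latEdge d N) B Z y := by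
  have h : SConn (latEdge d N) Z B y ↔ SConn (latEdge d N) B Z y := by
    constructor
    · rintro ⟨u, hu, b, hb, hr⟩; exact ⟨b, hb, u, hu, yReach_symm (latEdge_symm N) hr⟩
    · rintro ⟨u, hu, b, hb, hr⟩; exact ⟨b, hb, u, hu, yReach_symm (latEdge_symm N) hr⟩
  unfold gcross
  by_cases hZ : SConn (latEdge d N) Z B y
  · rw [if_pos hZ, if_pos (h.1 hZ)]
  · rw [if_neg hZ, if_neg (fun h' => hZ (h.2 h'))]

/-- Symmetry of the pivotality: `P(e pivotal for {Z ↔ B}) = P(e pivotal for {B ↔ Z})`.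
[cite: DewanMuirhead2022, §2 proof of Prop. 2.2 ("by symmetry")] -/
theorem pivCross_swap {N : ℕ} (q : PairIdx d N → ℝ) (Z B : Set (BoxV d N)) (e : PairIdx d N) :
    pivCross (latEdge d N) q Z B e = pivCross (latEdge d N) q B Z e := by
  classical
  unfold pivCross
  simp_rw [gcross_swap Z B]

/-- `𝟙{Z ↔ B}` on the cube is increasing: opening pairs preserves the crossing.
[cite: DewanMuirhead2022, §2 (Cross_k(R) increasing)] -/
theorem sconn_mono {N : ℕ} {Z B : Set (BoxV d N)} {x x' : PairIdx d N → Bool} (hle : ∀ e, x e = true → x' e = true)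
    (h : SConn (latEdge d N) Z B x) : SConn (latEdge d N) Z B x' := by
  obtain ⟨u, hu, b, hb, hr⟩ := h
  exact ⟨u, hu, b, hb, yReach_mono hle hr⟩

/-- THE PIVOTALITY BRIDGE: for a lattice pair `e` of `Λ(N)`,
`P_p(e pivotal for boxCrossing d L N) = ∑_y w(y)·(𝟙(y^{e→1}) − 𝟙(y^{e→0}))` (`pivCross` of the inner/outer spheres).
[cite: DewanMuirhead2022, §2 eq. (2.4) (Russo's formula for Cross_k(R))] -/
theorem real_pivotal_eq_pivCross (hd : 1 ≤ d) {L N : ℕ} (hLN : L ≤ N) (p : unitInterval) (e : PairIdx d N)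
    (he : e.1 ∈ (zdGraph d).edgeSet) :
    (bondPercolation (zdGraph d) p).real {ω | e.1 ∈ (zdGraph d).edgeSet ∧ IsPivotal (boxCrossing d L N) e.1 ω}
      = pivCross (latEdge d N) (boxBias d N p) (sphereSeed d N L) (sphereSeed d N N) e := by
  classical
  set P : (PairIdx d N → Bool) → Prop :=
    fun x => SConn (latEdge d N) (sphereSeed d N L) (sphereSeed d N N) x with hP
  -- Step 1: replace the crossing event by its cube reading (they agree on lattice configurations)
  have hae : (bondPercolation (zdGraph d) p).real
      {ω | e.1 ∈ (zdGraph d).edgeSet ∧ IsPivotal (boxCrossing d L N) e.1 ω}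
      = (bondPercolation (zdGraph d) p).real {ω | IsPivotal {ω | P (toCube N ω)} e.1 ω} := by
    have hiff : ∀ ω, ω ⊆ (zdGraph d).edgeSet →
        (IsPivotal (boxCrossing d L N) e.1 ω ↔ IsPivotal {ω | P (toCube N ω)} e.1 ω) := by
      intro ω hω
      have h1 : insert e.1 ω ⊆ (zdGraph d).edgeSet := Set.insert_subset he hω
      have h2 : ω \ {e.1} ⊆ (zdGraph d).edgeSet := fun x hx => hω hx.1
      have e1 : insert e.1 ω ∈ boxCrossing d L N ↔ insert e.1 ω ∈ {ω | P (toCube N ω)} :=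
        (sconn_iff_mem_boxCrossing hd hLN h1).symm
      have e2 : ω \ {e.1} ∈ boxCrossing d L N ↔ ω \ {e.1} ∈ {ω | P (toCube N ω)} :=
        (sconn_iff_mem_boxCrossing hd hLN h2).symm
      unfold IsPivotal
      rw [e1, e2]
    refine le_antisymm ?_ ?_
    · exact real_mono_of_forall_subset_edgeSet (zdGraph d) p fun ω hω h => (hiff ω hω).1 h.2
    · exact real_mono_of_forall_subset_edgeSet (zdGraph d) p fun ω hω h => ⟨he, (hiff ω hω).2 h⟩
  rw [hae]
  -- Step 2: the cube pivotality event
  have hmono : ∀ x : PairIdx d N → Bool, P (update x e false) → P (update x e true) := by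
    intro x h
    refine sconn_mono (fun e' he' => ?_) h
    by_cases hee : e' = e
    · subst hee; simp at he'
    · rwa [update_of_ne hee] at he' ⊢
  have hev : {ω : BondConfig (Site d) | IsPivotal {ω | P (toCube N ω)} e.1 ω}
      = {ω | P (update (toCube N ω) e true) ∧ ¬ P (update (toCube N ω) e false)} := by
    ext ω
    simp only [Set.mem_setOf_eq, IsPivotal, toCube_insert, toCube_sdiff]
    constructor
    · intro h
      rcases h with ⟨h1, h2⟩ | ⟨h1, h2⟩
      · exact ⟨h1, h2⟩
      · exact absurd (hmono _ h1) h2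
    · rintro ⟨h1, h2⟩
      exact Or.inl ⟨h1, h2⟩
  rw [hev, real_setOf_toCube N p (fun x => P (update x e true) ∧ ¬ P (update x e false))]
  unfold pivCross
  refine Finset.sum_congr rfl fun x _ => ?_
  congr 1
  unfold gcross
  by_cases h1 : P (update x e true) <;> by_cases h0 : P (update x e false)
  · rw [if_pos h1, if_pos h0, if_neg (fun h => h.2 h0)]; ring
  · rw [if_pos h1, if_neg h0, if_pos ⟨h1, h0⟩]; ring
  · exact absurd (hmono x h0) h1
  · rw [if_neg h1, if_neg h0, if_neg (fun h => h1 h.1)]; ring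

/-- Pairs that are not lattice edges are never pivotal edges of `ℤ^d`: their Russo term vanishes.
[cite: Russo1981, §4 Lemma 3 (only coordinates of the product space contribute)] -/
theorem real_pivotal_eq_zero_of_not_mem {L N : ℕ} (p : unitInterval) (e : PairIdx d N)
    (he : e.1 ∉ (zdGraph d).edgeSet) :
    (bondPercolation (zdGraph d) p).real {ω | e.1 ∈ (zdGraph d).edgeSet ∧ IsPivotal (boxCrossing d L N) e.1 ω}
      = 0 := by
  have : {ω : BondConfig (Site d) | e.1 ∈ (zdGraph d).edgeSet ∧ IsPivotal (boxCrossing d L N) e.1 ω} = ∅ := by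
    ext ω; simp [he]
  rw [this, measureReal_empty]

/-- The cube pivotality weighted by `b_e(1−b_e)` is `p(1−p)` times Russo's term (both vanish off the lattice edges).
[cite: DewanMuirhead2022, §2 eq. (2.4) (Russo's formula)] -/
theorem bias_mul_pivCross_eq (hd : 1 ≤ d) {L N : ℕ} (hLN : L ≤ N) (p : unitInterval) (e : PairIdx d N) :
    boxBias d N p e * (1 - boxBias d N p e)
        * pivCross (latEdge d N) (boxBias d N p) (sphereSeed d N L) (sphereSeed d N N) e
      = (p : ℝ) * (1 - p) * (bondPercolation (zdGraph d) p).real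
          {ω | e.1 ∈ (zdGraph d).edgeSet ∧ IsPivotal (boxCrossing d L N) e.1 ω} := by
  classical
  by_cases he : e.1 ∈ (zdGraph d).edgeSet
  · rw [real_pivotal_eq_pivCross hd hLN p e he]
    unfold boxBias; rw [if_pos he]
  · rw [real_pivotal_eq_zero_of_not_mem p e he]
    unfold boxBias; rw [if_neg he]; ring

end Summit.CriticalPhenomena.PercolationContinuityZ3.Theorems.CrossingRevealment

end
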